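import Literature.MathematicalPhysics.QuantumFieldTheory.MullerSchiemann1987.MS87NonperturbativeBound
import Mathlib.Analysis.SpecialFunctions.Gaussian.GaussianIntegral
import HarnessLib

/-!
# Müller–Schiemann, *Continuum limit of a hierarchical SU(2) lattice gauge theory in 4 dimensions*
# (CMP 110, 1987), (5.5) p.276 — THE NORMALISATION `M = ∫dv[g(v)]²` OF (5.3) IS OF ORDER `β^{−3/2}`, UPPER HALF:
# `M ≤ (e^{2C}/(e√π))·β^{−3/2} + 2E²` from the small-field upper bound of (A₃) and the nonperturbative bound (A₂)
# on the group, via Weyl's integration formula and the half-line Gaussian integral — PROVED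
# (theorems only; no definition, no named fact)

statement-level skeleton of published theorems with citation tags; proofs where landed; nothing here is a claim about the Yang–Mills mass gap

[MullerSchiemann1987] V. F. Müller, J. Schiemann, Commun. Math. Phys. **110** (1987) 261–286, Sect. 5 p.275 (5.3) and
p.276 (5.5); Sect. 3 p.267 (A₂), (A₃); (2.18)–(2.19) p.265. Read by this seat on its own 3× page renders of the journal
scan (`renders-cmp110ms/`, PDF page = journal page − 260). Lean lane of the lit-balaban YM LIT SWEEP CONTEXT row X1
(register `MullerSchiemann1987/`); the model is the `d = 4` HIERARCHICAL `SU(2)` gauge model (Migdal's recursion), NOT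
lattice Yang–Mills. Companion of `MS87MLowerBound` (the lower half `M ≥ mβ^{−3/2}`, the half the sibling
`NonperturbativeBound.eq525` consumes); together the two files give (5.5) in the form `M ≍ β^{−3/2}` with explicit
constants (the print's refinement `{1 + 𝒪(β^{1−4α})}` of the constant is not formalised).

**What the paper prints.** (5.3) p.275: *«M = ∫dv[g(v)]².»* (5.5) p.276: *«From the assumptions (A₂) and (A₃) we can
easily deduce M = const β^{−3/2}{1 + 𝒪(β^{1−4α})}.»* (A₂) p.267: *«For y ∈ ℝ, |y| < (κ/2)β^{−α} and u ∈ G∖𝒢[iy, β^{−α}],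
|g̃(u, iy)| < exp{βy² − pβ^{1−2α}}»* (at `y = 0`: `|g(u)| < exp{−pβ^{1−2α}}` off the small-field region, i.e. for
`θ(u) ≥ β^{−α}` or `u₀ ≤ 0`); (A₃) p.267 (on the group via (2.16): `|g(v)| ≤ exp{−βθ(v)² + C}` for `θ(v) < β^{−α}`,
`C = (½c_λ + ⅓c_σ)β^{1−4α} + Dβ^{−2}`, the sibling `SmallFieldInputs.eq453_norm_le`).

**What this file proves (kernel-checked, 0 sorry, standard axioms; theorems only, no definition, no named fact).**
For ANY continuous `g : SU(2) → ℝ`, `β > 0`, any `ϱ`, with `|g(v)| ≤ exp{−βθ(v)² + C}` for `θ(v) < ϱ` and `|g(v)| ≤ E`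
for `θ(v) ≥ ϱ` (`θ(v) = centralAngle v ∈ [0, π]`):
**`M = ∫dv g(v)² ≤ (e^{2C}/(e√π))·β^{−3/2} + 2E²`** (`M_upper_bound`). Route: the continuous majorant
`g(v)² ≤ e^{2C}e^{−2βθ(v)²} + E²`; Weyl's formula (sibling `NonperturbativeBound.integral_comp_u0`) with
`arccos(cos θ) = θ`; `sin²θ·e^{−2βθ²} ≤ θ²e^{−2βθ²} ≤ (eβ)^{−1}e^{−βθ²}` (`x e^{−x} ≤ e^{−1}`); and
`∫₀^π e^{−βθ²}dθ ≤ ∫₀^∞ e^{−βθ²}dθ = ½√(π/β)` (Mathlib's `integral_gaussian_Ioi`), `sin² ≤ 1` for the `E²` part.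
With `ϱ = β^{−α}` and `E = exp{−pβ^{1−2α}}` this is the printed setting (`M_upper_bound_rpow`).

**Readings / scope (declared).** (i) The UPPER half of (5.5) up to the form of the constant; the `{1 + 𝒪(β^{1−4α})}`
refinement (a Laplace asymptotic with matching lower constant) is NOT formalised. (ii) `g` is a letter with (A₁)'s
continuity and the on-the-group consequences of (A₂), (A₃) as hypotheses, exactly as in the siblings; the exponentially
small `2E² = 2e^{−2pβ^{1−2α}}` is kept as printed by (A₂), not absorbed into `β^{−3/2}`. (iii) `dv = haarProbability`.

**Not claimed.** (5.5) as an asymptotic equality, (A₂), (A₃) themselves, Theorem 1, anything about lattice Yang–Mills or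
the Clay problem.
-/

open MeasureTheory intervalIntegral Set

namespace Literature.MathematicalPhysics.QuantumFieldTheory

namespace MullerSchiemann1987

namespace MUpperBound

open Literature.MathematicalPhysics.QuantumFieldTheory (haarProbability)
open HeatKernel (u0 continuous_u0 abs_u0_le_one centralAngle centralAngle_eq_arccos_u0)
open NonperturbativeBound (integral_comp_u0)

/-- A continuous function on `SU(2)` is integrable for the Haar probability measure. [folklore] -/
private theorem integrable_of_continuous {f : Matrix.specialUnitaryGroup (Fin 2) ℂ → ℝ} (hf : Continuous f) :
    Integrable f (haarProbability (Matrix.specialUnitaryGroup (Fin 2) ℂ)) :=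
  hf.integrable_of_hasCompactSupport (HasCompactSupport.of_compactSpace _)

/-- `x e^{−x} ≤ e^{−1}` for all real `x` (`x ≤ e^{x−1}`). [folklore] -/
private theorem mul_exp_neg_le (x : ℝ) : x * Real.exp (-x) ≤ Real.exp (-1) := by
  have h1 : x ≤ Real.exp (x - 1) := by have := Real.add_one_le_exp (x - 1); linarith
  have h2 : Real.exp (x - 1) * Real.exp (-x) = Real.exp (-1) := by rw [← Real.exp_add]; ring_nf
  calc x * Real.exp (-x) ≤ Real.exp (x - 1) * Real.exp (-x) :=
        mul_le_mul_of_nonneg_right h1 (Real.exp_pos _).le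
    _ = Real.exp (-1) := h2

/-- `∫₀^π e^{−βθ²}dθ ≤ ½√(π/β)` (`β > 0`): the half-line Gaussian integral dominates. [folklore] -/
private theorem integral_exp_neg_sq_le {β : ℝ} (hβ : 0 < β) :
    ∫ θ in (0:ℝ)..Real.pi, Real.exp (-β * θ ^ 2) ≤ Real.sqrt (Real.pi / β) / 2 := by
  rw [intervalIntegral.integral_of_le Real.pi_pos.le, ← integral_gaussian_Ioi β]
  refine setIntegral_mono_set (integrable_exp_neg_mul_sq hβ).integrableOn ?_ ?_
  · exact Filter.Eventually.of_forall fun θ => (Real.exp_pos _).le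
  · exact Filter.Eventually.of_forall fun θ hθ => hθ.1

/-- **(5.5), UPPER HALF: `M = ∫dv g(v)² ≤ (e^{2C}/(e√π))·β^{−3/2} + 2E²`** for any continuous `g` on `SU(2)` with the
small-field upper bound `|g(v)| ≤ exp{−βθ(v)² + C}` for `θ(v) < ϱ` ((A₃) on the group) and `|g(v)| ≤ E` for
`θ(v) ≥ ϱ` ((A₂) at `y = 0`), `β > 0` (no sign or size condition on `E`, `ϱ` is needed). («From the assumptions (A₂) and (A₃) we can easily deduce
M = const β^{−3/2}{1 + 𝒪(β^{1−4α})}».) [cite: MullerSchiemann1987, (5.5) p.276; (5.3) p.275; (A₂), (A₃) p.267] -/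
theorem M_upper_bound {g : Matrix.specialUnitaryGroup (Fin 2) ℂ → ℝ} {β ρ C E : ℝ} (hg : Continuous g) (hβ : 0 < β)
    (hA3 : ∀ v : Matrix.specialUnitaryGroup (Fin 2) ℂ, centralAngle v < ρ →
      |g v| ≤ Real.exp (-(β * centralAngle v ^ 2) + C))
    (hA2 : ∀ v : Matrix.specialUnitaryGroup (Fin 2) ℂ, ρ ≤ centralAngle v → |g v| ≤ E) :
    ∫ v, g v ^ 2 ∂(haarProbability (Matrix.specialUnitaryGroup (Fin 2) ℂ)) ≤
      Real.exp (2 * C) / (Real.exp 1 * Real.sqrt Real.pi) * β ^ (-(3 / 2 : ℝ)) + 2 * E ^ 2 := by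
  have hπ := Real.pi_pos
  -- the continuous majorant in the variable `c = v₀`: `Ψ(c) = e^{2C} e^{−2β·arccos(c)²} + E²`
  set Ψ : ℝ → ℝ := fun c => Real.exp (2 * C) * Real.exp (-(2 * β) * Real.arccos c ^ 2) + E ^ 2 with hΨ
  have hΨc : Continuous Ψ := by
    refine (continuous_const.mul ?_).add continuous_const
    exact Real.continuous_exp.comp (continuous_const.mul (Real.continuous_arccos.pow 2))
  -- pointwise `g(v)² ≤ Ψ(v₀)`
  have hpt : ∀ v : Matrix.specialUnitaryGroup (Fin 2) ℂ, g v ^ 2 ≤ Ψ (u0 v) := by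
    intro v
    have hθ : Real.arccos (u0 v) = centralAngle v := (centralAngle_eq_arccos_u0 v).symm
    have hsq : g v ^ 2 = |g v| ^ 2 := (sq_abs _).symm
    have h0 : 0 ≤ Real.exp (2 * C) * Real.exp (-(2 * β) * Real.arccos (u0 v) ^ 2) := by positivity
    rcases lt_or_ge (centralAngle v) ρ with hlt | hge
    · have h1 := hA3 v hlt
      have h2 : |g v| ^ 2 ≤ Real.exp (-(β * centralAngle v ^ 2) + C) ^ 2 := pow_le_pow_left₀ (abs_nonneg _) h1 2
      have h3 : Real.exp (-(β * centralAngle v ^ 2) + C) ^ 2 =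
          Real.exp (2 * C) * Real.exp (-(2 * β) * Real.arccos (u0 v) ^ 2) := by
        rw [sq, ← Real.exp_add, ← Real.exp_add, hθ]; ring_nf
      rw [hsq]
      calc |g v| ^ 2 ≤ Real.exp (2 * C) * Real.exp (-(2 * β) * Real.arccos (u0 v) ^ 2) := by rw [← h3]; exact h2
        _ ≤ Ψ (u0 v) := by simp only [hΨ]; nlinarith [sq_nonneg E]
    · have h1 := hA2 v hge
      have h2 : |g v| ^ 2 ≤ E ^ 2 := pow_le_pow_left₀ (abs_nonneg _) h1 2
      rw [hsq]
      calc |g v| ^ 2 ≤ E ^ 2 := h2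
        _ ≤ Ψ (u0 v) := by simp only [hΨ]; linarith
  -- integrate and apply Weyl's formula
  have hint : ∫ v, g v ^ 2 ∂(haarProbability (Matrix.specialUnitaryGroup (Fin 2) ℂ)) ≤
      ∫ v, Ψ (u0 v) ∂(haarProbability (Matrix.specialUnitaryGroup (Fin 2) ℂ)) :=
    integral_mono (integrable_of_continuous (hg.pow 2)) (integrable_of_continuous (hΨc.comp continuous_u0)) hpt
  rw [integral_comp_u0 Ψ hΨc] at hint
  -- bound the angular integrand on `[0, π]` by `e^{2C}(eβ)^{−1}e^{−βθ²} + E²`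
  set F : ℝ → ℝ := fun θ => Real.sin θ ^ 2 * Ψ (Real.cos θ) with hF
  set G : ℝ → ℝ := fun θ => Real.exp (2 * C) * (Real.exp (-1) / β) * Real.exp (-β * θ ^ 2) + E ^ 2 with hG
  have hFc : Continuous F := (Real.continuous_sin.pow 2).mul (hΨc.comp Real.continuous_cos)
  have hGc : Continuous G := by
    refine (continuous_const.mul ?_).add continuous_const
    exact Real.continuous_exp.comp (continuous_const.mul (continuous_pow 2))
  have hFG : ∀ θ ∈ Icc (0:ℝ) Real.pi, F θ ≤ G θ := by
    intro θ hθ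
    obtain ⟨hθ0, hθπ⟩ := hθ
    have hac : Real.arccos (Real.cos θ) = θ := Real.arccos_cos hθ0 hθπ
    have hs1 : Real.sin θ ^ 2 ≤ 1 := by
      rw [sq_le_one_iff_abs_le_one]; exact Real.abs_sin_le_one θ
    have hs2 : Real.sin θ ^ 2 ≤ θ ^ 2 := by
      have h := Real.sin_le hθ0
      have h' : 0 ≤ Real.sin θ := Real.sin_nonneg_of_nonneg_of_le_pi hθ0 hθπ
      exact pow_le_pow_left₀ h' h 2
    have hs0 : 0 ≤ Real.sin θ ^ 2 := sq_nonneg _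
    -- `θ² e^{−2βθ²} ≤ (eβ)^{−1} e^{−βθ²}`
    have hx : θ ^ 2 * Real.exp (-(2 * β) * θ ^ 2) ≤ Real.exp (-1) / β * Real.exp (-β * θ ^ 2) := by
      have h := mul_exp_neg_le (β * θ ^ 2)
      have hq : θ ^ 2 * Real.exp (-(β * θ ^ 2)) ≤ Real.exp (-1) / β := by
        rw [le_div_iff₀ hβ]
        calc θ ^ 2 * Real.exp (-(β * θ ^ 2)) * β = β * θ ^ 2 * Real.exp (-(β * θ ^ 2)) := by ring
          _ ≤ Real.exp (-1) := h
      have e1 : Real.exp (-(2 * β) * θ ^ 2) = Real.exp (-(β * θ ^ 2)) * Real.exp (-β * θ ^ 2) := by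
        rw [← Real.exp_add]; ring_nf
      rw [e1, ← mul_assoc]
      exact mul_le_mul_of_nonneg_right hq (Real.exp_pos _).le
    have hE2 : 0 ≤ Real.exp (2 * C) := (Real.exp_pos _).le
    calc F θ = Real.sin θ ^ 2 * (Real.exp (2 * C) * Real.exp (-(2 * β) * θ ^ 2)) + Real.sin θ ^ 2 * E ^ 2 := by
          simp only [hF, hΨ, hac]; ring
      _ ≤ θ ^ 2 * (Real.exp (2 * C) * Real.exp (-(2 * β) * θ ^ 2)) + 1 * E ^ 2 := by
          gcongr
      _ = Real.exp (2 * C) * (θ ^ 2 * Real.exp (-(2 * β) * θ ^ 2)) + E ^ 2 := by ring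
      _ ≤ Real.exp (2 * C) * (Real.exp (-1) / β * Real.exp (-β * θ ^ 2)) + E ^ 2 := by
          gcongr
      _ = G θ := by simp only [hG]; ring
  have hmono : ∫ θ in (0:ℝ)..Real.pi, F θ ≤ ∫ θ in (0:ℝ)..Real.pi, G θ :=
    intervalIntegral.integral_mono_on hπ.le (hFc.intervalIntegrable (μ := volume) _ _)
      (hGc.intervalIntegrable (μ := volume) _ _) hFG
  -- `∫₀^π G = e^{2C}(eβ)^{−1}∫₀^π e^{−βθ²} + πE² ≤ e^{2C}(eβ)^{−1}·½√(π/β) + πE²`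
  have hGint : ∫ θ in (0:ℝ)..Real.pi, G θ =
      Real.exp (2 * C) * (Real.exp (-1) / β) * (∫ θ in (0:ℝ)..Real.pi, Real.exp (-β * θ ^ 2)) + E ^ 2 * Real.pi := by
    have i1 : IntervalIntegrable (fun θ : ℝ => Real.exp (2 * C) * (Real.exp (-1) / β) * Real.exp (-β * θ ^ 2))
        volume 0 Real.pi :=
      (continuous_const.mul (Real.continuous_exp.comp (continuous_const.mul (continuous_pow 2)))).intervalIntegrable
        (μ := volume) _ _
    have i2 : IntervalIntegrable (fun _ : ℝ => E ^ 2) volume 0 Real.pi :=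
      continuous_const.intervalIntegrable (μ := volume) _ _
    simp only [hG]
    rw [intervalIntegral.integral_add i1 i2, intervalIntegral.integral_const_mul, intervalIntegral.integral_const,
      sub_zero, smul_eq_mul]
    ring
  have hgauss := integral_exp_neg_sq_le hβ
  have hK0 : 0 ≤ Real.exp (2 * C) * (Real.exp (-1) / β) := by positivity
  have htot : ∫ θ in (0:ℝ)..Real.pi, F θ ≤
      Real.exp (2 * C) * (Real.exp (-1) / β) * (Real.sqrt (Real.pi / β) / 2) + E ^ 2 * Real.pi := by
    rw [hGint] at hmono
    exact hmono.trans (by nlinarith [mul_le_mul_of_nonneg_left hgauss hK0])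
  -- assemble: `(2/π)·e^{2C}·(eβ)^{−1}·½√(π/β) = e^{2C}/(e√π)·β^{−3/2}` and `(2/π)·πE² = 2E²`
  have h2π : 0 < 2 / Real.pi := by positivity
  have hfinal : 2 / Real.pi * (Real.exp (2 * C) * (Real.exp (-1) / β) * (Real.sqrt (Real.pi / β) / 2) + E ^ 2 * Real.pi)
      = Real.exp (2 * C) / (Real.exp 1 * Real.sqrt Real.pi) * β ^ (-(3 / 2 : ℝ)) + 2 * E ^ 2 := by
    have hsb : Real.sqrt (Real.pi / β) = Real.sqrt Real.pi / Real.sqrt β := Real.sqrt_div hπ.le β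
    have hβ32 : β ^ (-(3 / 2 : ℝ)) = (β * Real.sqrt β)⁻¹ := by
      rw [Real.rpow_neg hβ.le, show (3 / 2 : ℝ) = 1 + 1 / 2 by norm_num, Real.rpow_add hβ, Real.rpow_one,
        Real.sqrt_eq_rpow]
    have hsπ : 0 < Real.sqrt Real.pi := Real.sqrt_pos.mpr hπ
    have hsβ : 0 < Real.sqrt β := Real.sqrt_pos.mpr hβ
    have hππ : Real.sqrt Real.pi * Real.sqrt Real.pi = Real.pi := Real.mul_self_sqrt hπ.le
    rw [hsb, hβ32, Real.exp_neg]
    field_simp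
    linear_combination Real.exp (2 * C) * hππ
  calc ∫ v, g v ^ 2 ∂(haarProbability (Matrix.specialUnitaryGroup (Fin 2) ℂ))
        ≤ 2 / Real.pi * ∫ θ in (0:ℝ)..Real.pi, F θ := hint
    _ ≤ 2 / Real.pi * (Real.exp (2 * C) * (Real.exp (-1) / β) * (Real.sqrt (Real.pi / β) / 2) + E ^ 2 * Real.pi) :=
          mul_le_mul_of_nonneg_left htot h2π.le
    _ = _ := hfinal

/-- **(5.5), upper half, in the printed setting** `ϱ = β^{−α}`, `E = exp{−pβ^{1−2α}}` ((A₂) at `y = 0`):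
`M ≤ (e^{2C}/(e√π))·β^{−3/2} + 2exp{−2pβ^{1−2α}}`. [cite: MullerSchiemann1987, (5.5) p.276; (A₂), (A₃) p.267] -/
theorem M_upper_bound_rpow {g : Matrix.specialUnitaryGroup (Fin 2) ℂ → ℝ} {β α p C : ℝ} (hg : Continuous g)
    (hβ : 0 < β)
    (hA3 : ∀ v : Matrix.specialUnitaryGroup (Fin 2) ℂ, centralAngle v < β ^ (-α) →
      |g v| ≤ Real.exp (-(β * centralAngle v ^ 2) + C))
    (hA2 : ∀ v : Matrix.specialUnitaryGroup (Fin 2) ℂ, β ^ (-α) ≤ centralAngle v →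
      |g v| ≤ Real.exp (-(p * β ^ (1 - 2 * α)))) :
    ∫ v, g v ^ 2 ∂(haarProbability (Matrix.specialUnitaryGroup (Fin 2) ℂ)) ≤
      Real.exp (2 * C) / (Real.exp 1 * Real.sqrt Real.pi) * β ^ (-(3 / 2 : ℝ)) +
        2 * Real.exp (-(2 * p * β ^ (1 - 2 * α))) := by
  have h := M_upper_bound hg hβ hA3 hA2
  have e : Real.exp (-(p * β ^ (1 - 2 * α))) ^ 2 = Real.exp (-(2 * p * β ^ (1 - 2 * α))) := by
    rw [sq, ← Real.exp_add]; ring_nf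
  rwa [e] at h

end MUpperBound

end MullerSchiemann1987

end Literature.MathematicalPhysics.QuantumFieldTheory
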